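import Summits.HubbardSuperconductivity.HubbardSuperconductivity.Theorems.BalabanIRBirGroundStateAverageLROWindowUniformisationCountable
import Summits.HubbardSuperconductivity.HubbardSuperconductivity.Theorems.BalabanIRBirEveryGroundStateSocket

/-!
# Route BalabanIR — target `BirGroundStateAverageLRO`: per-coupling summit-strength pair order on a window ⇒ the target off countably many couplings

Helper file `--supports stmt-HubbardSuperconductivity-2079` (THESES-FREE: imports the Theses-free
modules `…WindowUniformisationCountable` and `…BirEveryGroundStateSocket` only). The unconditional,
countable form of the cross-route bridge recorded conditionally by lead c18
(`Theorems/BalabanIRBirGroundStateAverageLROWindowUniformisation.lean`,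
`birWindowFloor_of_forall_hasDWavePairFieldLROAt`, which takes the continuity of the ground
projection off closed sets `C L` as a hypothesis and imports the route file):

* `re_trace_projMatrix_map_mul_ge_of_forall_unit` — state-wise floor ⇒ trace floor
  (`c · Re tr P_E ≤ Re tr (P_E A)` if every unit vector of `E` has `c ≤ Re ⟨ψ, A ψ⟩`; frame
  expansion `Literature.MathematicalPhysics.QuantumLattice.exists_frame_trace_projMatrix_map_mul`);
* `dWaveAvg_uniform_offCountable_of_forall_hasDWavePairFieldLROAt` — if the summit's matrix
  `Literature.Barriers.HubbardSuperconductivity.HasDWavePairFieldLROAt U δ` (every sequence of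
  normalised sector ground states has `d_{x²-y²}` pair-field LRO — the per-coupling output a
  `WeakCouplingBCS`-type route aims at) holds at EVERY coupling of a window `(U₁, U₂)`, then on a
  sub-window ONE constant `c > 0` and ONE `L₀` give the target's inner inequality
  `c · L⁴ · Re tr P ≤ Re tr (P Δ_d† Δ_d)` for all even `L ≥ L₀` at every coupling outside closed,
  nowhere dense, COUNTABLE sets `C L` (`forall_hasLRO_iff_groundState_bound` turns the matrix into
  an every-ground-state floor `c_U L⁴`, the first item into the trace floor, and
  `dWaveAvg_uniform_offCountable_of_pointwise` uniformises);
* `birGroundStateAverageLRO_coCountable_of_forall_hasDWavePairFieldLROAt` — the same in the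
  target's quantifier shape with `U ∉ X`, `X` countable, inserted.

What separates this from the target as typed is exactly the countable set of exceptional
couplings. All statements are folklore given the cited modules; no definition is introduced.
-/

noncomputable section

namespace Summit.HubbardSuperconductivity.HubbardSuperconductivity.Theorems

open Matrix Set Filter Topology
open Literature.MathematicalPhysics.QuantumLattice Literature.Probability.LatticeModels
open Literature.Computability.AlgebraicComplexity Literature.Barriers.HubbardSuperconductivity

/-- **State-wise floor ⇒ trace floor.** If every unit vector `ψ` of a subspace `E ≤ ℂ^n` has
`c ≤ Re ⟨ψ, A ψ⟩`, then `c · Re tr P_E ≤ Re tr (P_E A)` for the orthogonal projection `P_E`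
(`tr (P_E A) = Σⱼ ⟨bⱼ, A bⱼ⟩` over an orthonormal frame of `E`, `Re tr P_E = dim E`). [folklore] -/
theorem re_trace_projMatrix_map_mul_ge_of_forall_unit {n : Type*} [Fintype n] [DecidableEq n]
    (E : Submodule ℂ (n → ℂ)) (A : Matrix n n ℂ) (c : ℝ)
    (h : ∀ ψ ∈ E, star ψ ⬝ᵥ ψ = 1 → c ≤ (star ψ ⬝ᵥ A *ᵥ ψ).re) :
    c * (projMatrix (E.map
        ((WithLp.linearEquiv 2 ℂ (n → ℂ)).symm : (n → ℂ) →ₗ[ℂ] EuclideanSpace ℂ n))).trace.re ≤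
      (projMatrix (E.map
        ((WithLp.linearEquiv 2 ℂ (n → ℂ)).symm : (n → ℂ) →ₗ[ℂ] EuclideanSpace ℂ n)) * A).trace.re := by
  obtain ⟨k, b, hk, hbE, hb1, htr⟩ := exists_frame_trace_projMatrix_map_mul E
  rw [re_trace_projMatrix_map_eq_finrank, ← hk, htr, Complex.re_sum]
  calc c * (k : ℝ) = ∑ _j : Fin k, c := by simp [mul_comm]
    _ ≤ ∑ j, (star (b j) ⬝ᵥ A *ᵥ b j).re := Finset.sum_le_sum fun j _ => h (b j) (hbE j) (hb1 j)

/-- **Per-coupling summit-strength pair LRO on a window ⇒ ONE constant on a sub-window, off closed,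
nowhere dense, countable sets of couplings.** If `HasDWavePairFieldLROAt U δ` holds at every
coupling of a window `(U₁, U₂)` (`δ ≥ -1`), then there are `U₁ ≤ U₁' < U₂' ≤ U₂`, `c > 0`, `L₀` and
closed, nowhere dense, countable `C L ⊆ ℝ` with the target's inner inequality
`c · L⁴ · Re tr P ≤ Re tr (P Δ_d† Δ_d)` for all even `L ≥ L₀` at every `U ∈ (U₁', U₂') ∖ C L`.
Unconditional, countable version of
`BirGroundStateAverageLRO.Uniformisation.birWindowFloor_of_forall_hasDWavePairFieldLROAt`.
[folklore] -/
theorem dWaveAvg_uniform_offCountable_of_forall_hasDWavePairFieldLROAt {δ U₁ U₂ : ℝ}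
    (hδ : -1 ≤ δ) (hU : U₁ < U₂) (h : ∀ U ∈ Set.Ioo U₁ U₂, HasDWavePairFieldLROAt U δ) :
    ∃ U₁' U₂' c : ℝ, U₁ ≤ U₁' ∧ U₁' < U₂' ∧ U₂' ≤ U₂ ∧ 0 < c ∧
      ∃ C : ℕ → Set ℝ, (∀ L, IsClosed (C L) ∧ IsNowhereDense (C L) ∧ (C L).Countable) ∧
        ∃ L₀ : ℕ, ∀ U ∈ Set.Ioo U₁' U₂', ∀ (L : ℕ) [NeZero L], L₀ ≤ L → Even L → U ∉ C L →
        let N : ℕ := 2 * ⌊(1 - δ) * (L : ℝ) ^ 2 / 2⌋₊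
        let H := hubbardTorus 2 L 1 U
        let S := szSector (Λ := FermionTorus 2 L) N 0
        let E₀ := S ⊓ Module.End.eigenspace (Matrix.toLin' H) ((H.minEnergyOn S : ℝ) : ℂ)
        let P := projMatrix (E₀.map (Fock.toEuclidean (ι := Orb (FermionTorus 2 L)) :
          Fock (Orb (FermionTorus 2 L)) →ₗ[ℂ] EuclideanSpace ℂ (Finset (Orb (FermionTorus 2 L)))))
        c * (L : ℝ) ^ 4 * P.trace.re ≤
          (P * (Matrix.conjTranspose (pairField dWaveFormFactor L) *
            pairField dWaveFormFactor L)).trace.re := by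
  refine dWaveAvg_uniform_offCountable_of_pointwise hδ hU fun U hUW => ?_
  obtain ⟨c, hc, L₀, hL₀⟩ := (forall_hasLRO_iff_groundState_bound U δ hδ).mp (h U hUW)
  refine ⟨c, hc, L₀, fun L _ hL hLe => ?_⟩
  intro N H S E₀ P
  refine re_trace_projMatrix_map_mul_ge_of_forall_unit E₀ _ (c * (L : ℝ) ^ 4) fun ψ hψ hunit => ?_
  obtain ⟨hψS, hψE⟩ := Submodule.mem_inf.mp hψ
  rw [Module.End.mem_eigenspace_iff, Matrix.toLin'_apply] at hψE
  have hψ0 : ψ ≠ 0 := by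
    rintro rfl
    simp at hunit
  exact hL₀ L hL hLe ψ ⟨hψS, hψ0, hψE⟩ hunit

/-- **Per-coupling summit-strength pair LRO on a window ⇒ the co-countable target** (the target's
quantifier shape with `U ∉ X`, `X` countable, inserted; `0 < U₁`, `δ ∈ (0,½)` as in the target).
[folklore] -/
theorem birGroundStateAverageLRO_coCountable_of_forall_hasDWavePairFieldLROAt {δ U₁ U₂ : ℝ}
    (hδ : δ ∈ Set.Ioo (0:ℝ) (1/2)) (hU₁ : 0 < U₁) (hU : U₁ < U₂)
    (h : ∀ U ∈ Set.Ioo U₁ U₂, HasDWavePairFieldLROAt U δ) :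
    ∃ δ ∈ Set.Ioo (0:ℝ) (1/2), ∃ U₁ U₂ c : ℝ, 0 < U₁ ∧ U₁ < U₂ ∧ 0 < c ∧
      ∃ X : Set ℝ, X.Countable ∧
        ∀ U ∈ Set.Ioo U₁ U₂, U ∉ X → ∃ L₀ : ℕ, ∀ (L : ℕ) [NeZero L], L₀ ≤ L → Even L →
        let N : ℕ := 2 * ⌊(1 - δ) * (L : ℝ) ^ 2 / 2⌋₊
        let H := hubbardTorus 2 L 1 U
        let S := szSector (Λ := FermionTorus 2 L) N 0
        let E₀ := S ⊓ Module.End.eigenspace (Matrix.toLin' H) ((H.minEnergyOn S : ℝ) : ℂ)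
        let P := projMatrix (E₀.map (Fock.toEuclidean (ι := Orb (FermionTorus 2 L)) :
          Fock (Orb (FermionTorus 2 L)) →ₗ[ℂ] EuclideanSpace ℂ (Finset (Orb (FermionTorus 2 L)))))
        c * (L : ℝ) ^ 4 * P.trace.re ≤
          (P * (Matrix.conjTranspose (pairField dWaveFormFactor L) *
            pairField dWaveFormFactor L)).trace.re := by
  obtain ⟨a, b, c, ha, hab, _, hc, C, hC, L₀, hCL⟩ :=
    dWaveAvg_uniform_offCountable_of_forall_hasDWavePairFieldLROAt (by linarith [hδ.1]) hU h
  refine ⟨δ, hδ, a, b, c, by linarith, hab, hc, ⋃ L, C L,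
    Set.countable_iUnion fun L => (hC L).2.2, fun U hU' hUX => ⟨L₀, fun L _ hL hLe => ?_⟩⟩
  exact hCL U hU' L hL hLe fun hUC => hUX (Set.mem_iUnion.2 ⟨L, hUC⟩)

end Summit.HubbardSuperconductivity.HubbardSuperconductivity.Theorems
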